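import Summits.Ventures.PercRepro.C025ProfilePriceGen
import Summits.Ventures.PercRepro.C025ProfileAll

/-!
# C-032 «PROFILE (Π)» — the parallel-pair step at EVERY `q`, and the reduction to SIMPLE matroids (night-3 g7)

`profileIneq_of_delete_parallel_gen`: for a loopless finite matroid with `e ∥ f` and `q ≤ u`,
`(Π_{q+1,u+1})(M ＼ e)` and `(Π_{q,u})(M ／ e)` give `(Π_{q+1,u+1})(M)`. The level splits
(`card_levelSet_of_indep_singleton`); the rank-`(q+1)` sets of `M` are those of `M ＼ e` (members avoiding `e`) and
`insert e D` for the rank-`q` sets `D` of `M ／ e`; with `Y` := the rank-`(q+1)` sets of `M ＼ e` that are rank-`q` sets of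
`M ／ e` (i.e. `e ∈ cl B`): off `Y` a member avoiding `e` has `e ∉ cl B`, hence `f ∉ B`, hence `e ∈ cl((E∖e)∖B)` and its
price is unchanged in `M ＼ e` (G1); every `insert e D` is paid by the `M ／ e`-price of `D` (G2); on `Y` the pair
`B`, `insert e B` is paid by the two minors together (G3). This is g6's `profileIneq_one_of_delete_parallel` with the
parallel class replaced by the family `Y` and `P1`/`P0` by the general prices (C025ProfilePriceGen).

`profileIneq_of_simple_all`: **(Π_{q,u}) for every finite matroid follows from (Π_{q,u}) for simple matroids** (all
`q < u`), by strong induction on `|E|` — a loop: `profileIneq_of_delete_isLoop`; a parallel pair: the step above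
(`q = 0` is `profileIneq_zero`); otherwise `M` is simple. This is the kernel form of the dossier's §7(d) (Theorem D's
reduction), by single-element minors instead of the parallel-class generating function.
-/

open scoped Matroid

namespace PercRepro

open Set Finset ThmH

section SimpleReduction

variable {α : Type} [DecidableEq α] {M : Matroid α} [M.Finite]

/-- A rank-`(q+1)` set `B ⊆ E ∖ e` of `M ＼ e` that is NOT a rank-`q` set of `M ／ e` has `e ∉ cl(B)`. -/
theorem notMem_closure_of_notMem_Rq_contract {e : α} (he : M.Indep {e}) {q : ℕ} {B : Finset α}
    (hB : B ∈ Profile.Rq (M ＼ ({e} : Set α)) (q + 1)) (hB' : B ∉ Profile.Rq (M ／ ({e} : Set α)) q) :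
    e ∉ M.closure (B : Set α) := by
  intro hcl
  apply hB'
  rw [Profile.mem_Rq, gr_delete_singleton''] at hB
  rw [Profile.mem_Rq, gr_contract_singleton]
  refine ⟨hB.1, ?_⟩
  have hBE : (B : Set α) ⊆ M.E \ {e} := by
    intro x hx; rw [Finset.mem_coe] at hx
    have := hB.1 hx; rw [Finset.mem_erase] at this
    exact ⟨by rw [← coe_gr]; exact_mod_cast this.2, by rw [Set.mem_singleton_iff]; exact this.1⟩
  have h1 := contract_singleton_eRk_add_one he hBE
  rw [eRk_insert_eq_of_mem_closure (hBE.trans Set.sdiff_subset) hcl, ← delete_singleton_eRk_eq hBE, hB.2] at h1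
  have h2 : (M ／ ({e} : Set α)).eRk (B : Set α) + 1 = (q : ℕ∞) + 1 := by rw [h1]; push_cast; rfl
  exact WithTop.add_right_cancel (ENat.coe_ne_top 1) h2

/-- **The parallel-pair step of `(Π)` at every `q`**: for a loopless matroid with `e ∥ f` and `q ≤ u`,
`(Π_{q+1,u+1})` on `M ＼ {e}` and `(Π_{q,u})` on `M ／ {e}` give `(Π_{q+1,u+1})` on `M`. -/
theorem profileIneq_of_delete_parallel_gen (hl : ∀ x ∈ M.E, M.IsNonloop x) {e f : α} (hfE : f ∈ M.E) (hfe : f ≠ e)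
    (hef : e ∈ M.closure {f}) {q u : ℕ} (hqu : q ≤ u)
    (h1 : Profile.ProfileIneq (M ＼ ({e} : Set α)) (q + 1) (u + 1)) (h2 : Profile.ProfileIneq (M ／ ({e} : Set α)) q u) :
    Profile.ProfileIneq M (q + 1) (u + 1) := by
  classical
  have heE : e ∈ M.E := M.closure_subset_ground _ hef
  have he : M.Indep {e} := M.indep_singleton.2 (hl e heE)
  have heg : e ∈ gr M := by rw [← Finset.mem_coe, coe_gr]; exact heE
  unfold Profile.ProfileIneq at h1 h2 ⊢
  -- split the rank-(q+1) sets of M by e ∈ B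
  rw [← Finset.sum_filter_add_sum_filter_not (Profile.Rq M (q + 1)) (fun B => e ∈ B)]
  have hS1 : (Profile.Rq M (q + 1)).filter (fun B => ¬ e ∈ B) = Profile.Rq (M ＼ ({e} : Set α)) (q + 1) :=
    filter_notMem_levelSet_eq e (q + 1)
  have hS0 : ((Profile.Rq M (q + 1)).filter (fun B => e ∈ B)).image (fun B => B.erase e) =
      Profile.Rq (M ／ ({e} : Set α)) q := image_erase_filter_mem_levelSet_eq he q
  have hsum0 : ∑ B ∈ (Profile.Rq M (q + 1)).filter (fun B => e ∈ B), Profile.price M (q + 1) (u + 1) B =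
      ∑ D ∈ Profile.Rq (M ／ ({e} : Set α)) q, Profile.price M (q + 1) (u + 1) (insert e D) := by
    rw [← hS0, Finset.sum_image (erase_injOn_filter_mem _ e)]
    apply Finset.sum_congr rfl
    intro B hB
    rw [Finset.insert_erase (Finset.mem_filter.1 hB).2]
  rw [hsum0, hS1]
  -- the common family Y
  set Y : Finset (Finset α) :=
    (Profile.Rq (M ＼ ({e} : Set α)) (q + 1)).filter (fun B => B ∈ Profile.Rq (M ／ ({e} : Set α)) q) with hY
  have hY1 : Y ⊆ Profile.Rq (M ＼ ({e} : Set α)) (q + 1) := Finset.filter_subset _ _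
  have hY2 : Y ⊆ Profile.Rq (M ／ ({e} : Set α)) q := fun B hB => (Finset.mem_filter.1 hB).2
  have hsubE : ∀ B ∈ Profile.Rq (M ＼ ({e} : Set α)) (q + 1), B ⊆ (gr M).erase e := by
    intro B hB
    rw [Profile.mem_Rq, gr_delete_singleton''] at hB
    exact hB.1
  -- off Y: the price is unchanged in M ＼ e
  have hoff : ∀ B ∈ Profile.Rq (M ＼ ({e} : Set α)) (q + 1) \ Y,
      Profile.price M (q + 1) (u + 1) B = Profile.price (M ＼ ({e} : Set α)) (q + 1) (u + 1) B := by
    intro B hB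
    rw [Finset.mem_sdiff] at hB
    have hBsub := hsubE B hB.1
    have hB' : B ∉ Profile.Rq (M ／ ({e} : Set α)) q := by
      intro h; exact hB.2 (Finset.mem_filter.2 ⟨hB.1, h⟩)
    have hcl := notMem_closure_of_notMem_Rq_contract he hB.1 hB'
    have hfB : f ∉ B := by
      intro hfB
      exact hcl (M.closure_subset_closure (Set.singleton_subset_iff.2 (by exact_mod_cast hfB)) hef)
    have hfX : f ∈ (M.E \ {e}) \ (B : Set α) :=
      ⟨⟨hfE, by rw [Set.mem_singleton_iff]; exact hfe⟩, by rw [Finset.mem_coe]; exact hfB⟩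
    exact price_eq_price_delete_of_mem_closure_gen heg _ _ hBsub
      (M.closure_subset_closure (Set.singleton_subset_iff.2 hfX) hef)
  -- on Y: the pair is paid by the two minors
  have hpair : ∀ B ∈ Y, Profile.price M (q + 1) (u + 1) B + Profile.price M (q + 1) (u + 1) (insert e B) ≤
      Profile.price (M ＼ ({e} : Set α)) (q + 1) (u + 1) B + Profile.price (M ／ ({e} : Set α)) q u B :=
    fun B hB => price_pair_le_gen he hqu (hsubE B (hY1 hB))
  -- off Y on the contraction side
  have hcontr : ∀ D ∈ Profile.Rq (M ／ ({e} : Set α)) q \ Y,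
      Profile.price M (q + 1) (u + 1) (insert e D) ≤ Profile.price (M ／ ({e} : Set α)) q u D :=
    fun D _ => price_insert_le_price_contract_gen he hqu D
  have hlev := card_levelSet_of_indep_singleton he u
  -- assemble
  have hA : ∑ B ∈ Profile.Rq (M ＼ ({e} : Set α)) (q + 1), Profile.price M (q + 1) (u + 1) B =
      ∑ B ∈ Profile.Rq (M ＼ ({e} : Set α)) (q + 1) \ Y, Profile.price (M ＼ ({e} : Set α)) (q + 1) (u + 1) B +
        ∑ B ∈ Y, Profile.price M (q + 1) (u + 1) B := by
    rw [← Finset.sum_sdiff hY1, Finset.sum_congr rfl hoff]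
  have hB : ∑ D ∈ Profile.Rq (M ／ ({e} : Set α)) q, Profile.price M (q + 1) (u + 1) (insert e D) ≤
      ∑ D ∈ Profile.Rq (M ／ ({e} : Set α)) q \ Y, Profile.price (M ／ ({e} : Set α)) q u D +
        ∑ B ∈ Y, Profile.price M (q + 1) (u + 1) (insert e B) := by
    rw [← Finset.sum_sdiff hY2]
    exact add_le_add (Finset.sum_le_sum hcontr) le_rfl
  have hC : ∑ B ∈ Profile.Rq (M ＼ ({e} : Set α)) (q + 1), Profile.price (M ＼ ({e} : Set α)) (q + 1) (u + 1) B =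
      ∑ B ∈ Profile.Rq (M ＼ ({e} : Set α)) (q + 1) \ Y, Profile.price (M ＼ ({e} : Set α)) (q + 1) (u + 1) B +
        ∑ B ∈ Y, Profile.price (M ＼ ({e} : Set α)) (q + 1) (u + 1) B := (Finset.sum_sdiff hY1).symm
  have hD : ∑ D ∈ Profile.Rq (M ／ ({e} : Set α)) q, Profile.price (M ／ ({e} : Set α)) q u D =
      ∑ D ∈ Profile.Rq (M ／ ({e} : Set α)) q \ Y, Profile.price (M ／ ({e} : Set α)) q u D +
        ∑ B ∈ Y, Profile.price (M ／ ({e} : Set α)) q u B := (Finset.sum_sdiff hY2).symm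
  have hpairs := Finset.sum_le_sum hpair
  rw [Finset.sum_add_distrib, Finset.sum_add_distrib] at hpairs
  rw [hlev]
  push_cast
  linarith [hA, hB, hC, hD, hpairs, h1, h2]

/-- **(Π) for every finite matroid reduces to (Π) for simple matroids**: if `(Π_{q,u})` holds for every simple finite
matroid and every `q < u`, it holds for every finite matroid and every `q < u`. -/
theorem profileIneq_of_simple_all
    (hS : ∀ (N : Matroid α) [N.Finite], (∀ T ⊆ N.E, T.encard ≤ 2 → N.Indep T) →
      ∀ q u : ℕ, q < u → Profile.ProfileIneq N q u)
    (M : Matroid α) [M.Finite] (q u : ℕ) (hqu : q < u) : Profile.ProfileIneq M q u := by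
  suffices h : ∀ n : ℕ, ∀ (N : Matroid α) [N.Finite], (gr N).card = n →
      ∀ q u : ℕ, q < u → Profile.ProfileIneq N q u from h _ M rfl q u hqu
  intro n
  induction n using Nat.strong_induction_on with
  | _ n ih =>
  intro N _ hN q u hqu
  by_cases hloop : ∃ ℓ, N.IsLoop ℓ
  · obtain ⟨ℓ, hℓ⟩ := hloop
    have hℓE : ℓ ∈ gr N := by rw [← Finset.mem_coe, coe_gr]; exact hℓ.mem_ground
    apply profileIneq_of_delete_isLoop hℓ
    apply ih ((gr N).erase ℓ).card _ (N ＼ ({ℓ} : Set α)) (by rw [gr_delete_singleton'']) q u hqu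
    rw [← hN]; exact Finset.card_erase_lt_of_mem hℓE
  · have hl : ∀ x ∈ N.E, N.IsNonloop x := fun x hx => N.isNonloop_of_not_isLoop hx (fun h => hloop ⟨x, h⟩)
    by_cases hpar : ∃ e f, f ∈ N.E ∧ f ≠ e ∧ e ∈ N.closure {f}
    · obtain ⟨e, f, hfE, hfe, hef⟩ := hpar
      have heE : e ∈ gr N := by rw [← Finset.mem_coe, coe_gr]; exact N.closure_subset_ground _ hef
      have hlt : ((gr N).erase e).card < n := by rw [← hN]; exact Finset.card_erase_lt_of_mem heE
      rcases Nat.eq_zero_or_pos q with hq0 | hqpos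
      · subst hq0
        exact profileIneq_zero u
      · obtain ⟨q', rfl⟩ : ∃ q', q = q' + 1 := ⟨q - 1, by omega⟩
        obtain ⟨u', rfl⟩ : ∃ u', u = u' + 1 := ⟨u - 1, by omega⟩
        apply profileIneq_of_delete_parallel_gen hl hfE hfe hef (by omega)
        · exact ih _ hlt (N ＼ ({e} : Set α)) (by rw [gr_delete_singleton'']) (q' + 1) (u' + 1) hqu
        · exact ih _ hlt (N ／ ({e} : Set α)) (by rw [gr_contract_singleton]) q' u' (by omega)
    · push Not at hpar
      exact hS N (simple_of_no_loop_no_parallel hl hpar) q u hqu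

end SimpleReduction

end PercRepro
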